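/-
Copyright (c) 2026 the pub-hodgecm-mathlib formalisation cell (harness21).  Prover seat hodgecm-mathlib-K2E5-p17 (g5), Track B «K2-LIT» ∕ h413
(`stmt-HodgeConjecture-24833`), line `K2_E3_EllipticInputs`, road «GL₂-sc» (road owner K2E5-p17 (g5); dealer RULINGS #1 (R-2) 2026-09-04 08:53Z), brick (2F-c):
the `N = 2` twin of ★ (B0c) `K2E3GL3SupercuspidalTwistDescent` §1∕§3 + `K2E3GL3SupercuspidalTwistDescentTwist` (K2E3-p21 (g4)) — unramified twist and descent
of a supercuspidal representation of `GL₂(F)` to `G_Λ = GL₂(F) ⧸ ϖ^ℤ·1`.  2026-09-04.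
-/
import Summits.HodgeConjecture.HodgeConjecture.Theorems.K2E3GL3SupercuspidalTwistDescent      -- ★ B0c file 1 p857846 (K2E3-p21 (g4)): §2 GENERIC descent `quotientLift` kit (reused, not restated)
import Literature.NumberTheory.Automorphic.SmoothRepresentationCentralCharacterProofs         -- ★ `Representation.exists_hasCentralCharacter_holds` (Schur for admissible irreducibles)
import Literature.NumberTheory.Automorphic.CongruenceSubgroupExpansionGL                       -- ★ `nonarchimedeanGroup_gl`
import Literature.NumberTheory.Automorphic.GLnGelfandKazhdanInvolution                         -- ★ `locallyCompactSpace_generalLinearGroup`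
import HarnessLib

/-!
# K2_E3 road (h413), road «GL₂-sc», brick (2F-c) — unramified twist and descent of a supercuspidal `GL₂(F)`-representation to `G_Λ = GL₂(F) ⧸ ϖ^ℤ·1`

Cell `pub/hodgecm-mathlib` (D-0151), Track B, seat K2E5-p17 (g5) (road owner «GL₂-sc» = Harish-Chandra's local integrability for supercuspidal `GL₂(F)`, the letter
(S-C′-GL₂sc) of the hosted leaf (nsc-S-C′); census `K2/K2E5-p17/g5/CENSUS-GL2sc.K2E5-p17-g5.md` §2).  `--supports stmt-HodgeConjecture-24833 --as helper`; THEOREMS ONLY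
(no definition ∕ instance ∕ notation ∕ named fact ∕ `sorry`); never imports `Cruxes/…/Lines`.  COUNT-NEUTRAL.  The `N = 2` TWIN, statement for statement, of the
`GL₃` bricks ★ B0c (`K2E3GL3SupercuspidalTwistDescent` §1∕§3, `K2E3GL3SupercuspidalTwistDescentTwist`): the only changes are `Fin 3 ↦ Fin 2` and the exponent
`3 ↦ 2` (a SQUARE root of the central character value instead of a cube root); the generic descent kit §2 of ★ file 1 is imported, not restated.

* §1 `exists_unramified_sqRoot` — for every `z ∈ ℂ^×` an unramified character `χ` of `F^×` (open kernel, trivial on `𝒪^×`) with `χ(ϖ)² = z`.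
* §2 `map_scalar_zpowers_le_ker`, **`exists_smoothIrrep_quotScalar`** — `r` irreducible smooth on `GL₂(F)` with `r(ϖ·1) = 1` descends to `G_Λ` (same space,
  supercuspidal ∕ admissible preserved).
* §3 `continuous_det`, `isOpen_ker_comp_det`, `det_scalar_eq_pow` (`det(c·1) = c²`), `exists_apply_scalar_eq_smul` (Schur at `c·1`),
  **`exists_unramified_twist_apply_scalar_eq_one`** (`(r ⊗ χ∘det)(ϖ·1) = 1` for an unramified `χ`), **`exists_unramified_twist_descends`** (packaged).
[BushnellHenniart2006, §1.1–§2.1, §2.6 Cor. 1, §11.1]; [HarishChandra1970, Part I §3 p. 9].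
HONEST LABEL: HC_CM is proved only modulo the 7 printed citations (2 remaining named inputs: hLiu418 = stmt-HodgeConjecture-24832, h413 =
stmt-HodgeConjecture-24833) until rung 0 closes; count-neutral helper.
-/

set_option autoImplicit false
set_option linter.dupNamespace false   -- `Summit.HodgeConjecture.HodgeConjecture.…` (D-0017 nested layout; lakefile exemption for Summits)

noncomputable section

open Filter Topology TopologicalSpace Function
open scoped MatrixGroups WithZero Valued
open Literature.NumberTheory.Automorphic
open Summit.HodgeConjecture.HodgeConjecture.Cruxes.H413.K2E3GL3SupercuspidalTwistDescent

namespace Summit.HodgeConjecture.HodgeConjecture.Cruxes.H413.K2E3GL2SupercuspidalTwistDescent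

/-! ## §1  Unramified characters of `F^×` with prescribed square at a uniformiser -/

section SqRoot

variable {F : Type*} [Field F] [Valued F ℤᵐ⁰]

/-- **`exists_unramified_sqRoot`.**  For a uniformiser `ϖ` (`v(ϖ) = exp(−1)`) and every `z ∈ ℂ^×` there is a character `χ : F^× → ℂ^×` with OPEN kernel, trivial
on `𝒪^× = {u : v(u) = 1}` (unramified), and `χ(ϖ)² = z` (`χ = z₀^{−log ∘ v}` with `z₀² = z`). [cite: BushnellHenniart2006, §11.1] -/
theorem exists_unramified_sqRoot {ϖ : F} (hϖ : Valued.v ϖ = WithZero.exp (-1 : ℤ)) (hϖ0 : ϖ ≠ 0) (z : ℂˣ) :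
    ∃ χ : Fˣ →* ℂˣ, IsOpen (χ.ker : Set Fˣ) ∧ (∀ u : Fˣ, Valued.v (u : F) = 1 → χ u = 1) ∧ χ (Units.mk0 ϖ hϖ0) ^ 2 = z := by
  -- a square root `z₀` of `z` in `ℂ^×`
  obtain ⟨z₀, hz₀⟩ := IsAlgClosed.exists_pow_nat_eq (z : ℂ) (by norm_num : 0 < 2)
  have hz₀0 : z₀ ≠ 0 := fun h => z.ne_zero (by rw [← hz₀, h]; norm_num)
  set ζ : ℂˣ := Units.mk0 z₀ hz₀0 with hζ
  have hv0 : ∀ u : Fˣ, Valued.v (u : F) ≠ 0 := fun u => (Valuation.ne_zero_iff _).2 u.ne_zero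
  -- `χ(u) = ζ^{−log v(u)}`
  let χ : Fˣ →* ℂˣ :=
    { toFun := fun u => ζ ^ (-(WithZero.log (Valued.v (u : F))))
      map_one' := by simp
      map_mul' := fun a b => by
        simp only [Units.val_mul, map_mul, WithZero.log_mul (hv0 a) (hv0 b), neg_add, zpow_add] }
  have hχ : ∀ u : Fˣ, χ u = ζ ^ (-(WithZero.log (Valued.v (u : F)))) := fun _ => rfl
  have hunit : ∀ u : Fˣ, Valued.v (u : F) = 1 → χ u = 1 := fun u hu => by
    rw [hχ, hu, WithZero.log_one, neg_zero, zpow_zero]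
  refine ⟨χ, ?_, hunit, ?_⟩
  · -- the kernel contains the open neighbourhood `{u | v u = 1}` of `1`
    have hopen : IsOpen {u : Fˣ | Valued.v (u : F) = 1} := by
      have hF : IsOpen {x : F | Valued.v x = 1} := by
        rw [isOpen_iff_mem_nhds]
        intro x hx
        have h := Valued.locally_const (show (Valued.v x : ℤᵐ⁰) ≠ 0 by rw [hx]; exact one_ne_zero)
        rw [hx] at h
        exact h
      exact hF.preimage Units.continuous_val
    refine Subgroup.isOpen_of_mem_nhds _ (g := 1) (Filter.mem_of_superset (hopen.mem_nhds (by simp)) fun u hu => ?_)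
    exact (MonoidHom.mem_ker).2 (hunit u hu)
  · rw [hχ, Units.val_mk0, hϖ, WithZero.log_exp, neg_neg, zpow_one]
    exact Units.ext (by rw [Units.val_pow_eq_pow_val, hζ, Units.val_mk0, hz₀])

end SqRoot

/-! ## §2  Descent to `G_Λ = GL₂(F) ⧸ Λ·1`, `Λ = ϖ^ℤ` (the generic kit is ★ B0c §2) -/

section GL2

variable {F : Type*} [Field F] [Valued F ℤᵐ⁰] [ValuativeRel F] [IsNonarchimedeanLocalField F]

omit [ValuativeRel F] [IsNonarchimedeanLocalField F] in
/-- `Λ·1 ≤ ker r.ρ` for `Λ = ϖ^ℤ` as soon as `r.ρ(ϖ·1) = 1`. [folklore] -/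
theorem map_scalar_zpowers_le_ker {ϖ : F} (hϖ0 : ϖ ≠ 0) (r : SmoothIrrep (GL (Fin 2) F))
    (hr : r.ρ (Matrix.GeneralLinearGroup.scalar (Fin 2) (Units.mk0 ϖ hϖ0)) = 1) :
    (Subgroup.zpowers (Units.mk0 ϖ hϖ0)).map (Matrix.GeneralLinearGroup.scalar (Fin 2)) ≤ r.ρ.ker := by
  rw [Subgroup.map_le_iff_le_comap, Subgroup.zpowers_le, Subgroup.mem_comap, MonoidHom.mem_ker]
  exact hr

/-- **THE DESCENT PACKAGE `r ↦ r♭` FOR `GL₂`.**  For `r` an irreducible smooth representation of `GL₂(F)` with `r.ρ(ϖ·1) = 1` there is an irreducible smooth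
representation `r♭` of `G_Λ = GL₂(F) ⧸ Λ·1` (`Λ = ϖ^ℤ`) on the same space (`e = id`), with `r♭(π g) = r(g)`, supercuspidal if `r` is, admissible if `r` is
(`r♭.ρ = QuotientGroup.lift _ r.ρ _`, ★ B0c §2 with `K₀ = GL₂(𝒪)`). [cite: BushnellHenniart2006, §1.1–§2.1] [cite: HarishChandra1970, Part I §3 p. 9] -/
theorem exists_smoothIrrep_quotScalar {ϖ : F} (hϖ0 : ϖ ≠ 0)
    [((Subgroup.zpowers (Units.mk0 ϖ hϖ0)).map (Matrix.GeneralLinearGroup.scalar (Fin 2))).Normal]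
    (r : SmoothIrrep (GL (Fin 2) F)) (hr : r.ρ (Matrix.GeneralLinearGroup.scalar (Fin 2) (Units.mk0 ϖ hϖ0)) = 1) :
    ∃ r' : SmoothIrrep (GL (Fin 2) F ⧸ (Subgroup.zpowers (Units.mk0 ϖ hϖ0)).map (Matrix.GeneralLinearGroup.scalar (Fin 2))),
      ∃ e : r'.V ≃ₗ[ℂ] r.V, (∀ (g : GL (Fin 2) F) (v : r'.V), e (r'.ρ (QuotientGroup.mk g) v) = r.ρ g (e v)) ∧
        (r.ρ.IsSupercuspidal → r'.ρ.IsSupercuspidal) ∧ (r.ρ.IsAdmissible → r'.ρ.IsAdmissible) := by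
  haveI : IsTopologicalRing F := inferInstance
  have hN := map_scalar_zpowers_le_ker hϖ0 r hr
  let K₀ : OpenSubgroup (GL (Fin 2) F) := ⟨glInt 2 F, isOpen_glInt 2 F⟩
  refine ⟨⟨r.V, QuotientGroup.lift _ r.ρ hN, (isIrreducible_quotientLift_iff _ r.ρ hN).2 r.isIrreducible, isSmooth_quotientLift _ r.ρ hN r.isSmooth⟩,
    LinearEquiv.refl ℂ r.V, fun g v => ?_, isSupercuspidal_quotientLift _ r.ρ hN, isAdmissible_quotientLift _ r.ρ hN K₀ (isCompact_glInt 2 F)⟩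
  show (QuotientGroup.lift _ r.ρ hN : Representation ℂ _ r.V) (QuotientGroup.mk g) v = r.ρ g v
  rw [quotientLift_mk]

end GL2

/-! ## §3  Twist-to-descend: an unramified `χ∘det` with `(r ⊗ χ∘det)(ϖ·1) = 1` -/

section Det

variable {F : Type*} [Field F] [TopologicalSpace F] [IsTopologicalRing F]

/-- `det : GL₂(F) → F^×` is continuous (for the unit topologies). [folklore] -/
theorem continuous_det : Continuous (Matrix.GeneralLinearGroup.det : GL (Fin 2) F → Fˣ) := by
  refine Units.continuous_iff.2 ⟨Units.continuous_val.matrix_det, ?_⟩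
  have h : (fun g : GL (Fin 2) F => ((Matrix.GeneralLinearGroup.det g)⁻¹ : Fˣ).val) =
      fun g => (((g⁻¹ : GL (Fin 2) F)) : Matrix (Fin 2) (Fin 2) F).det := by
    funext g; rw [← map_inv, Matrix.GeneralLinearGroup.val_det_apply]
  rw [h]
  exact Units.continuous_coe_inv.matrix_det

/-- `χ ∘ det` has open kernel when `χ` has. [folklore] -/
theorem isOpen_ker_comp_det {χ : Fˣ →* ℂˣ} (hχ : IsOpen (χ.ker : Set Fˣ)) :
    IsOpen ((χ.comp (Matrix.GeneralLinearGroup.det : GL (Fin 2) F →* Fˣ)).ker : Set (GL (Fin 2) F)) := by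
  rw [MonoidHom.comap_ker .. |>.symm, Subgroup.coe_comap]
  exact hχ.preimage continuous_det

omit [TopologicalSpace F] [IsTopologicalRing F] in
/-- `det(c·1) = c²` in `GL₂`. [folklore] -/
theorem det_scalar_eq_pow (c : Fˣ) : Matrix.GeneralLinearGroup.det (Matrix.GeneralLinearGroup.scalar (Fin 2) c) = c ^ 2 :=
  Units.ext (by
    rw [Matrix.GeneralLinearGroup.val_det_apply, Matrix.GeneralLinearGroup.coe_scalar, Matrix.scalar_apply, Matrix.det_diagonal, Finset.prod_const,
      Finset.card_univ, Fintype.card_fin, Units.val_pow_eq_pow_val])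

end Det

section Schur

variable {F : Type*} [Field F] [ValuativeRel F] [TopologicalSpace F] [IsNonarchimedeanLocalField F]

/-- **Central character at a scalar** (Schur, ★ `exists_hasCentralCharacter_holds`): an irreducible ADMISSIBLE `r` of `GL₂(F)` acts on `c·1` by a scalar `ω ∈ ℂ^×`.
[cite: BushnellHenniart2006, §2.6 Cor. 1] -/
theorem exists_apply_scalar_eq_smul (r : SmoothIrrep (GL (Fin 2) F)) (hr : r.ρ.IsAdmissible) (c : Fˣ) :
    ∃ ω : ℂˣ, r.ρ (Matrix.GeneralLinearGroup.scalar (Fin 2) c) = (ω : ℂ) • (LinearMap.id : r.V →ₗ[ℂ] r.V) := by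
  haveI : NonarchimedeanGroup (GL (Fin 2) F) := nonarchimedeanGroup_gl F 2
  haveI : LocallyCompactSpace (GL (Fin 2) F) := locallyCompactSpace_generalLinearGroup F 2
  obtain ⟨ω, hω⟩ := Representation.exists_hasCentralCharacter_holds r.ρ hr
  have hc : Matrix.GeneralLinearGroup.scalar (Fin 2) c ∈ Subgroup.center (GL (Fin 2) F) := by
    rw [Matrix.GeneralLinearGroup.center_eq_range_scalar]
    exact ⟨c, rfl⟩
  exact ⟨ω ⟨_, hc⟩, hω ⟨_, hc⟩⟩

end Schur

section Twist

variable {F : Type*} [Field F] [Valued F ℤᵐ⁰] [ValuativeRel F] [IsNonarchimedeanLocalField F]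

/-- **TWIST-TO-DESCEND for `GL₂`.**  For a uniformiser `ϖ` and an irreducible admissible `r` of `GL₂(F)` there is an UNRAMIFIED character `χ : F^× → ℂ^×` (open kernel,
trivial on `𝒪^×`) such that the twist `r ⊗ (χ ∘ det)` (★ `SmoothIrrep.twist`, open kernel `hχdet`) is TRIVIAL on `ϖ·1`: `(r ⊗ χ∘det)(ϖ·1) = 1` (`det(ϖ·1) = ϖ²`, `χ(ϖ)² = ω⁻¹`).
[cite: BushnellHenniart2006, §2.6 Cor. 1] [cite: BushnellHenniart2006, §11.1] -/
theorem exists_unramified_twist_apply_scalar_eq_one {ϖ : F} (hϖ : Valued.v ϖ = WithZero.exp (-1 : ℤ)) (hϖ0 : ϖ ≠ 0)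
    (r : SmoothIrrep (GL (Fin 2) F)) (hr : r.ρ.IsAdmissible) :
    ∃ (χ : Fˣ →* ℂˣ) (hχdet : IsOpen ((χ.comp (Matrix.GeneralLinearGroup.det : GL (Fin 2) F →* Fˣ)).ker : Set (GL (Fin 2) F))),
      IsOpen (χ.ker : Set Fˣ) ∧ (∀ u : Fˣ, Valued.v (u : F) = 1 → χ u = 1) ∧
        (r.twist (χ.comp Matrix.GeneralLinearGroup.det) hχdet).ρ (Matrix.GeneralLinearGroup.scalar (Fin 2) (Units.mk0 ϖ hϖ0)) = 1 := by
  haveI : IsTopologicalRing F := inferInstance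
  obtain ⟨ω, hω⟩ := exists_apply_scalar_eq_smul r hr (Units.mk0 ϖ hϖ0)
  obtain ⟨χ, hχo, hχu, hχ2⟩ := exists_unramified_sqRoot hϖ hϖ0 ω⁻¹
  refine ⟨χ, isOpen_ker_comp_det hχo, hχo, hχu, ?_⟩
  rw [SmoothIrrep.ρ_twist]
  show (((χ.comp Matrix.GeneralLinearGroup.det) (Matrix.GeneralLinearGroup.scalar (Fin 2) (Units.mk0 ϖ hϖ0)) : ℂˣ) : ℂ) •
      r.ρ (Matrix.GeneralLinearGroup.scalar (Fin 2) (Units.mk0 ϖ hϖ0)) = 1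
  rw [MonoidHom.comp_apply, det_scalar_eq_pow, map_pow, hχ2, hω, smul_smul, Units.val_inv_eq_inv_val, inv_mul_cancel₀ ω.ne_zero, one_smul]
  rfl

/-- **The descended twist, packaged**: with `χ` as above, the twist `r ⊗ χ∘det` descends to an irreducible smooth representation of `G_Λ = GL₂(F) ⧸ ϖ^ℤ·1` on the
same space, supercuspidal ∕ admissible when `r ⊗ χ∘det` is (§2 `exists_smoothIrrep_quotScalar`). [cite: BushnellHenniart2006, §11.1] -/
theorem exists_unramified_twist_descends {ϖ : F} (hϖ : Valued.v ϖ = WithZero.exp (-1 : ℤ)) (hϖ0 : ϖ ≠ 0)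
    [((Subgroup.zpowers (Units.mk0 ϖ hϖ0)).map (Matrix.GeneralLinearGroup.scalar (Fin 2))).Normal]
    (r : SmoothIrrep (GL (Fin 2) F)) (hr : r.ρ.IsAdmissible) :
    ∃ (χ : Fˣ →* ℂˣ) (hχdet : IsOpen ((χ.comp (Matrix.GeneralLinearGroup.det : GL (Fin 2) F →* Fˣ)).ker : Set (GL (Fin 2) F))),
      IsOpen (χ.ker : Set Fˣ) ∧ (∀ u : Fˣ, Valued.v (u : F) = 1 → χ u = 1) ∧
      ∃ r' : SmoothIrrep (GL (Fin 2) F ⧸ (Subgroup.zpowers (Units.mk0 ϖ hϖ0)).map (Matrix.GeneralLinearGroup.scalar (Fin 2))),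
        ∃ e : r'.V ≃ₗ[ℂ] (r.twist (χ.comp Matrix.GeneralLinearGroup.det) hχdet).V,
          (∀ (g : GL (Fin 2) F) (v : r'.V), e (r'.ρ (QuotientGroup.mk g) v) = (r.twist (χ.comp Matrix.GeneralLinearGroup.det) hχdet).ρ g (e v)) ∧
          ((r.twist (χ.comp Matrix.GeneralLinearGroup.det) hχdet).ρ.IsSupercuspidal → r'.ρ.IsSupercuspidal) ∧
          ((r.twist (χ.comp Matrix.GeneralLinearGroup.det) hχdet).ρ.IsAdmissible → r'.ρ.IsAdmissible) := by
  obtain ⟨χ, hχdet, hχo, hχu, h1⟩ := exists_unramified_twist_apply_scalar_eq_one hϖ hϖ0 r hr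
  exact ⟨χ, hχdet, hχo, hχu, exists_smoothIrrep_quotScalar hϖ0 _ h1⟩

end Twist

end Summit.HodgeConjecture.HodgeConjecture.Cruxes.H413.K2E3GL2SupercuspidalTwistDescent

end
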